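import Summits.NavierStokesRegularity.NavierStokesRegularity.Theses.TypeIQuarterGate
import Summits.NavierStokesRegularity.NavierStokesRegularity.Theorems.TypeIQuarterGateLorentzCeilingSparsity
import Summits.NavierStokesRegularity.NavierStokesRegularity.Theorems.TypeIQuarterGateLorentzUpgradeIffQuarterLaw
import Literature.Analysis.FunctionSpaces.WeakLp
import HarnessLib

/-!
# `TypeIQuarterGate`: near-ceiling sparsity — corollaries and the BY-NAME equivalences
# (crux `QuarterLawTypeI`, stmt-NavierStokesRegularity-23726; open stub `stub_lorentzUpgrade` = item 24108)

`--supports stmt-NavierStokesRegularity-23726` (helper, def-free).  Consequences of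
`LorentzCeiling.count_of_ceilingSparsity` (file `TypeIQuarterGateLorentzCeilingSparsity.lean`).  Along a
maximal classical Leray–Hopf solution from a rapidly decaying datum with the sup-norm Type-I rate at `T`,
call NEAR-CEILING SPARSITY the statement: for every fraction `κ > 0` there are `M, t₁ < T` with
`(κ/√(T−t))³ · |{x : κ/√(T−t) < ‖u(t,x)‖}| ≤ M` for all `t ∈ [t₁,T)` — the superlevel set at the
fraction `κ` of the Type-I amplitude scale `1/√(T−t)` fills at most `M/κ³` parabolic cells
`(T−t)^{3/2}`.  It is the weak-`L³` bound read at ONE `t`-dependent level per `κ`.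

* `ofReal_cube_mul_meas_lt_le_eWeakLpPow` — one real level is below the weak-`L³` quasinorm;
* `ceilingSparsity_of_lorentzBound` — the uniform weak-`L³` bound gives near-ceiling sparsity (trivial);
* `lorentzBound_of_ceilingSparsity` / `quarterLaw_of_ceilingSparsity` — near-ceiling sparsity gives the
  FULL weak-`L³` bound at all levels and all times (tree `LorentzOfEnvelope.lorentzBound_of_count`) and
  Leray's quarter law (tree `CountQuarterLaw.stub_countQuarterLaw`);
* BY NAME: `lorentzUpgradeTypeI_iff_ceilingSparsity`, `quarterLawTypeI_iff_ceilingSparsity`.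

Repair-census wording for 23726/24108: the weak-`L³` quasinorm of a sup-norm Type-I blow-up can
diverge ONLY through the amplitudes comparable to the ceiling `C/√(T−t)`; the 'intermediate-amplitude
cloud' of the docstring of `LorentzUpgradeTypeI` is, equivalently, a near-ceiling crowd (volume
`≫ (T−t)^{3/2}` above a fixed fraction of the ceiling) at earlier times.  Levels `λ ≤ Λ` are free by the
energy (`LorentzAmplitude.highAmplitudeEnergyLaw_of_large`), levels above the ceiling are empty.

HONEST FRAMING: a-priori statements along a HYPOTHETICAL Type-I blow-up; `LorentzUpgradeTypeI` (24108),
`QuarterLawTypeI` (23726) remain OPEN; nothing about Navier–Stokes regularity or blow-up is claimed and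
no summit statement is proved. [folklore]
-/

noncomputable section

-- the summit-side namespace repeats a component by design (D-0017)
set_option linter.dupNamespace false

namespace Summit.NavierStokesRegularity.NavierStokesRegularity.Theorems.LorentzCeiling

open Set MeasureTheory Function Metric Filter Topology
open scoped ENNReal NNReal
open Literature.Analysis.FluidPDE Literature.Analysis.FunctionSpaces
open Summit.NavierStokesRegularity.NavierStokesRegularity.Theorems.CountQuarterLaw

/-- One REAL level `s ≥ 0` is below the weak-`L³` quasinorm: `s³ μ{s < ‖f‖} ≤ sup_t t³ μ{t < ‖f‖}`.
[folklore] -/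
theorem ofReal_cube_mul_meas_lt_le_eWeakLpPow {α : Type*} [MeasurableSpace α] {E : Type*}
    [NormedAddCommGroup E] (f : α → E) (μ : Measure α) {s : ℝ} (hs : 0 ≤ s) :
    ENNReal.ofReal (s ^ 3) * μ {x | s < ‖f x‖} ≤ eWeakLpPow f 3 μ := by
  have hw := rpow_mul_meas_lt_le_eWeakLpPow f 3 μ (Real.toNNReal s)
  rw [show ((Real.toNNReal s : ℝ≥0) : ℝ≥0∞) = ENNReal.ofReal s from rfl, ENNReal.toReal_ofNat] at hw
  have hset : {y | ENNReal.ofReal s < ‖f y‖ₑ} = {y | s < ‖f y‖} := by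
    ext y
    simp only [mem_setOf_eq]
    rw [← ofReal_norm, ENNReal.ofReal_lt_ofReal_iff_of_nonneg hs]
  have hcoe : (ENNReal.ofReal s) ^ (3 : ℝ) = ENNReal.ofReal (s ^ 3) := by
    rw [ENNReal.ofReal_rpow_of_nonneg hs (by norm_num)]
    congr 1
    exact_mod_cast Real.rpow_natCast s 3
  rwa [hset, hcoe] at hw

variable {ν T : ℝ} {u : ℝ → EuclideanSpace ℝ (Fin 3) → EuclideanSpace ℝ (Fin 3)}
  {p : ℝ → EuclideanSpace ℝ (Fin 3) → ℝ}

/-- **Uniform weak-`L³` bound ⟹ near-ceiling sparsity** (read the bound at the level `κ/√(T−t)`;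
`T > 0`). [folklore] -/
theorem ceilingSparsity_of_lorentzBound (hT : 0 < T)
    (hW : ∃ M' : ℝ, ∀ t ∈ Ico 0 T, eWeakLpPow (u t) 3 volume ≤ ENNReal.ofReal M') :
    ∀ κ : ℝ, 0 < κ → ∃ M t₁ : ℝ, t₁ < T ∧ ∀ t ∈ Ico t₁ T,
      ENNReal.ofReal ((κ / Real.sqrt (T - t)) ^ 3) *
        volume {x | κ / Real.sqrt (T - t) < ‖u t x‖} ≤ ENNReal.ofReal M := by
  obtain ⟨M', hM'⟩ := hW
  intro κ hκ
  refine ⟨M', 0, hT, fun t ht => ?_⟩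
  exact (ofReal_cube_mul_meas_lt_le_eWeakLpPow (u t) volume
    (div_nonneg hκ.le (Real.sqrt_nonneg _))).trans (hM' t ht)

/-- **Near-ceiling sparsity ⟹ the FULL weak-`L³` bound** (all levels, all times in `[0,T)`), along a
maximal classical Leray–Hopf solution from a rapidly decaying datum with the sup-norm Type-I rate at
`T` (`count_of_ceilingSparsity` + tree `LorentzOfEnvelope.lorentzBound_of_count`).
[cite: BarkerPrange2020, Thm 1] -/
theorem lorentzBound_of_ceilingSparsity (hν : 0 < ν) (hT : 0 < T)
    (hmax : IsMaximalSmoothSolution ν 0 u p T) (hLH : IsLerayHopfOn T ν 0 (u 0) u)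
    (hdec : HasRapidSpatialDecay (u 0)) (hI : IsTypeIBlowup u T)
    (hceil : ∀ κ : ℝ, 0 < κ → ∃ M t₁ : ℝ, t₁ < T ∧ ∀ t ∈ Ico t₁ T,
      ENNReal.ofReal ((κ / Real.sqrt (T - t)) ^ 3) *
        volume {x | κ / Real.sqrt (T - t) < ‖u t x‖} ≤ ENNReal.ofReal M) :
    ∃ M' : ℝ, ∀ t ∈ Ico 0 T, eWeakLpPow (u t) 3 volume ≤ ENNReal.ofReal M' :=
  LorentzOfEnvelope.lorentzBound_of_count hν hT hmax.1 hLH hdec hI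
    (count_of_ceilingSparsity hν hT hmax hLH hdec hI hceil)

/-- **Near-ceiling sparsity ⟹ Leray's quarter law** `∫‖curl u(t)‖² ≤ K/√(T−t)` on `[0,T)`, along a
maximal classical Leray–Hopf solution from a rapidly decaying datum with the sup-norm Type-I rate
(`count_of_ceilingSparsity` + the registered stub `CountQuarterLaw.stub_countQuarterLaw`).
[cite: BarkerPrange2020, Thm 1] -/
theorem quarterLaw_of_ceilingSparsity (hν : 0 < ν) (hT : 0 < T)
    (hmax : IsMaximalSmoothSolution ν 0 u p T) (hLH : IsLerayHopfOn T ν 0 (u 0) u)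
    (hdec : HasRapidSpatialDecay (u 0)) (hI : IsTypeIBlowup u T)
    (hceil : ∀ κ : ℝ, 0 < κ → ∃ M t₁ : ℝ, t₁ < T ∧ ∀ t ∈ Ico t₁ T,
      ENNReal.ofReal ((κ / Real.sqrt (T - t)) ^ 3) *
        volume {x | κ / Real.sqrt (T - t) < ‖u t x‖} ≤ ENNReal.ofReal M) :
    ∃ K : ℝ, ∀ t ∈ Ico 0 T, ∫⁻ x, ‖curl (u t) x‖ₑ ^ 2 ≤ ENNReal.ofReal (K / Real.sqrt (T - t)) :=
  stub_countQuarterLaw ν T hν hT u p hmax hLH hdec hI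
    (count_of_ceilingSparsity hν hT hmax hLH hdec hI hceil)

/-- **Per solution: uniform weak-`L³` bound ⟺ near-ceiling sparsity** along a sup-norm Type-I maximal
classical Leray–Hopf blow-up from a rapidly decaying datum. [folklore] -/
theorem lorentzBound_iff_ceilingSparsity (hν : 0 < ν) (hT : 0 < T)
    (hmax : IsMaximalSmoothSolution ν 0 u p T) (hLH : IsLerayHopfOn T ν 0 (u 0) u)
    (hdec : HasRapidSpatialDecay (u 0)) (hI : IsTypeIBlowup u T) :
    (∃ M' : ℝ, ∀ t ∈ Ico 0 T, eWeakLpPow (u t) 3 volume ≤ ENNReal.ofReal M') ↔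
      ∀ κ : ℝ, 0 < κ → ∃ M t₁ : ℝ, t₁ < T ∧ ∀ t ∈ Ico t₁ T,
        ENNReal.ofReal ((κ / Real.sqrt (T - t)) ^ 3) *
          volume {x | κ / Real.sqrt (T - t) < ‖u t x‖} ≤ ENNReal.ofReal M :=
  ⟨ceilingSparsity_of_lorentzBound hT, lorentzBound_of_ceilingSparsity hν hT hmax hLH hdec hI⟩

/-! ### BY NAME -/

open Summit.NavierStokesRegularity.NavierStokesRegularity.Theses.TypeIQuarterGate

/-- **BY NAME: `LorentzUpgradeTypeI` ⟺ NEAR-CEILING SPARSITY.**  The open item 24108 (time-Type-I ⟹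
uniformly bounded weak-`L³` slices) is equivalent to: along every sup-norm Type-I maximal classical
Leray–Hopf blow-up from a rapidly decaying datum, for every fraction `κ > 0` there are `M, t₁ < T` with
`(κ/√(T−t))³ · |{x : κ/√(T−t) < ‖u(t,x)‖}| ≤ M` for all `t ∈ [t₁,T)`.  Only amplitudes comparable to
the Type-I ceiling decide 24108.  `LorentzUpgradeTypeI` remains OPEN. [folklore] -/
theorem lorentzUpgradeTypeI_iff_ceilingSparsity :
    LorentzUpgradeTypeI ↔
      ∀ (ν T : ℝ), 0 < ν → 0 < T →
        ∀ (u : ℝ → EuclideanSpace ℝ (Fin 3) → EuclideanSpace ℝ (Fin 3))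
          (p : ℝ → EuclideanSpace ℝ (Fin 3) → ℝ),
          IsMaximalSmoothSolution ν 0 u p T → IsLerayHopfOn T ν 0 (u 0) u →
          HasRapidSpatialDecay (u 0) → IsTypeIBlowup u T →
          ∀ κ : ℝ, 0 < κ → ∃ M t₁ : ℝ, t₁ < T ∧ ∀ t ∈ Set.Ico t₁ T,
            ENNReal.ofReal ((κ / Real.sqrt (T - t)) ^ 3) *
              volume {x | κ / Real.sqrt (T - t) < ‖u t x‖} ≤ ENNReal.ofReal M := by
  unfold LorentzUpgradeTypeI
  constructor
  · intro h ν T hν hT u p hmax hLH hdec hI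
    exact ceilingSparsity_of_lorentzBound hT (h ν T hν hT u p hmax hLH hdec hI)
  · intro h ν T hν hT u p hmax hLH hdec hI
    exact lorentzBound_of_ceilingSparsity hν hT hmax hLH hdec hI (h ν T hν hT u p hmax hLH hdec hI)

/-- **BY NAME: the crux `QuarterLawTypeI` ⟺ NEAR-CEILING SPARSITY** along Type-I blow-ups (via the
tree's `LorentzOfEnvelope.lorentzUpgradeTypeI_iff_quarterLawTypeI`).  `QuarterLawTypeI` remains OPEN.
[folklore] -/
theorem quarterLawTypeI_iff_ceilingSparsity :
    QuarterLawTypeI ↔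
      ∀ (ν T : ℝ), 0 < ν → 0 < T →
        ∀ (u : ℝ → EuclideanSpace ℝ (Fin 3) → EuclideanSpace ℝ (Fin 3))
          (p : ℝ → EuclideanSpace ℝ (Fin 3) → ℝ),
          IsMaximalSmoothSolution ν 0 u p T → IsLerayHopfOn T ν 0 (u 0) u →
          HasRapidSpatialDecay (u 0) → IsTypeIBlowup u T →
          ∀ κ : ℝ, 0 < κ → ∃ M t₁ : ℝ, t₁ < T ∧ ∀ t ∈ Set.Ico t₁ T,
            ENNReal.ofReal ((κ / Real.sqrt (T - t)) ^ 3) *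
              volume {x | κ / Real.sqrt (T - t) < ‖u t x‖} ≤ ENNReal.ofReal M :=
  LorentzOfEnvelope.lorentzUpgradeTypeI_iff_quarterLawTypeI.symm.trans
    lorentzUpgradeTypeI_iff_ceilingSparsity

end Summit.NavierStokesRegularity.NavierStokesRegularity.Theorems.LorentzCeiling

end
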